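import Literature.MathematicalPhysics.QuantumFieldTheory.Balaban1983to89.B9SectBStepWhole
import Literature.MathematicalPhysics.QuantumFieldTheory.Balaban1983to89.B9PinCarriersKLevelV1

/-!
# `Balaban1983to89.B9ResidualEntriesAtOne` — [B9] Cor. 3.5 (p. 407), the RESIDUAL ENTRIES AT U = 1 (`B9FromB6.ResidualGpAtOne`,
# `B9FromB6.ResidualGAGlobAtOne`: what «proved in [4]» does NOT print): their kernel-checked REDUCTION to separately pinnable per-block
# leaves at U = 1, and — at carriers whose argument type is a sum — to the blocks ON the operator's summand plus null readings OFF it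

T. Bałaban, *Propagators for lattice gauge theories in a background field*, Commun. Math. Phys. **99** (1985) 389–434
[`Balaban1985BackgroundPropagators`, "B9"]; [4] = T. Bałaban, *Propagators and renormalization transformations for lattice
gauge theories. II*, Commun. Math. Phys. **96** (1984) 223–250 [`Balaban1984PropagatorsII`].

statement-level skeleton of published theorems with citation tags; proofs where landed; nothing here is a claim about the
Yang–Mills mass gap

THE PRINTED LOCI (verbatim).  Corollary 3.5, p. 407: *"This allows us to prove Theorems 3.1–3.3 in some special situations, where
we can use the results of [4]. There we have proved these theorems for operators with the external gauge field configuration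
U = 1."*; Theorem 3.1, p. 398: the Hölder entries (3.43) *"for 0 ≦ β ≦ β₀ < 1, ζ ∈ C₀^∞(Δ̃(y)), y ∈ Λ_j, supp λ ⊂ Δ(y′)"*, (3.44)
*"for 0 < ε ≦ 1, x ∈ Δ(y), supp λ ⊂ Δ̃(y′)"*, (3.45), the L² entries (3.46) and *"the global inequalities |G′(U)λ|_{(2+γ)},
|∇_UG′(U)λ|_{(1+γ)}, |G′(U)∇*_Uλ|_{(1+γ)}, |∇_UG′(U)λ|_{(γ)} ≦ B₀|λ|_{(γ)} (3.47) for γ in a fixed compact subset of real numbers,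
e.g. for γ ∈ [−4, 4]"*; p. 398: *"It is easy to see that the global inequalities (3.47) are consequences of the local ones (3.42)
and Lemma 2.1."*  What [4] PRINTS at U = 1: Prop. 2.2 (2.67) p. 234 = the sup entries (3.42) of G′ = Δ′_a⁻¹ and its Hölder
entries for cut-offs *"supp ζ ⊂ B^j(y)"* (the small cube); Prop. 2.6 (2.136)–(2.140) p. 247 = (3.42)–(3.46) of G = Δ_a⁻¹.  NOT
printed in [4] (cell GAPS G-B9-03a, G-A1-1 (b), G-B9-20): for G′(1) the entries (3.43) with Δ̃-cut-offs, (3.44), (3.45), (3.46),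
(3.47); for G(1) the entries (3.47).  The tree's `U = 1` edge `B9FromB6.baseU1_of_B6` ∕ `B9FromB6ModelSignsOn.baseU1_of_B6_on`
therefore carries them as the two RESIDUAL hypotheses `ResidualGpAtOne geo bg Gp` (five blocks, ONE threshold M₁ and ONE constant
set) and `ResidualGAGlobAtOne geo bg GA` — obligations `hGp`, `hGA` of the N06 knit (`B9PinCarriersKLevelV1.b9LeafX_carriersY`,
`N06AtRecord11CB10YZW.b9_main_of_up_view₁₁B10YZW_of_obligations`; N06-ASSIGNMENT v1 rows 11–12).

THE POINT.  Whatever proves these entries proves them BLOCK BY BLOCK (and, for (3.46)∕(3.47), member by member), each with its own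
threshold and constants — exactly as the tree's Sect.-B programme does at U′U (n06-c's `B9SectBStepWhole`, row 13).  And at the
Stage-3′(Y) carriers of record (`geo9Y`, argument type `Loc` = torus-SITE functions ⊕ fine-BOND functions) an operator layer reads
G′ on the site summand and G on the bond summand, as NODE 00 does (`Node00.GpU` ∕ `Node00.GU`, `0` off the summand); there every
block at U = 1 is «the genuine estimate ON the operator's summand» + «a null reading OFF it», the second half holding by `rfl` at
such a layer (the mechanism of the knit's `hE4`∕`hH2`, `B9Cor35ComparisonsEH`).  THIS FILE is that bookkeeping:

* §1 the blocks of `B9FromB6` asked ON a sub-family `P` of arguments: `L2BlockOn`, `GlobBlockOn`, `H1BlockOn`, `E4BlockOn`, `H2BlockOn`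
  (`P ≡ True` is the block: `…_iff_on_true`; restriction `…On_of_…`); and ON `P` + null OFF `P` + `0 ≤` constant + the sign facts
  of the norms (3.39)–(3.41) (`ModelSignsOn g Q`, ANY `Q` — the Hölder-monotonicity field is not used) ⇒ the block
  (`l2Block_of_on_of_null`, …, `h2Block_of_on_of_null`).
* §2 the per-block LEAVES AT U = 1 for a family `K` ON `P`: `AtOneL2On`, `AtOneGlobOn`, `AtOneH1On`, `AtOneE4On`, `AtOneH2On` (∃ threshold,
  ∃ constants, the block ON `P i` at `(bg i).one` above the threshold), the per-member ones `AtOneL2nOn n` (n : Fin 6), `AtOneGlobnOn n`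
  (n : Fin 4), and the null readings OFF `P` at U = 1, `NullOffAtOne`.
* §3 the merges (thresholds max, constants max, rates min, Hölder constants floored at `0`; weakening by n06-c's `*_mono` lemmas):
  `atOneL2On_of_members`, `atOneGlobOn_of_members`; ★ `residualGpAtOne_of_blocksOn_of_null` (null OFF `P` + the five leaves ON `P` ⇒
  `ResidualGpAtOne geo bg K`), ★ `residualGAGlobAtOne_of_globOn_of_null`; the unrestricted corollaries (`P ≡ True`, no null hypothesis)
  ★ `residualGpAtOne_of_blocks`, `residualGAGlobAtOne_of_glob`; and the projections back (`atOneL2On_of_residualGpAtOne`, …: the leaves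
  are also NECESSARY, for every `P`).
* §4 AT THE STAGE-3′(Y) CARRIERS, family level over def-Y's signature `ops : ∀ x, OperatorLayerY d ℓ hd hL b₀ b₁ Mstar 𝔸 G x` (section
  variable; NODE 00's `OpsY N θ₃ M⋆` by unification), signs by dag-n03-b's `modelSignsOn_geo9K`: ★ `hGp_of_blocksOn_of_null` — the knit
  binder `hGp` from the five U = 1 leaves of `(ops ·).Gp` ON SITE ARGUMENTS + its null readings on bond arguments, of which the (3.43)
  one is itself a consequence of the knit binder `hGp_h1` (`Gp_h1_null_of_le_GpU`: NODE 00's `GpU.h1` vanishes on bond arguments);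
  ★ `hGA_of_globOn_of_null` — the knit binder `hGA` from the (3.47) leaf of `(ops ·).GA` ON BOND ARGUMENTS + its null reading on site
  arguments.

HONEST SCOPE.  Nothing of [B9] or [4] is asserted: every leaf is a HYPOTHESIS SCHEMA of printed shape, the file's content is the
quantifier ∕ constant ∕ summand bookkeeping; the leaves ON the summand ARE the cell's located Literature debt G-B9-03a ∕ G-A1-1 (b) ∕
G-B9-20 (in print: «proved in [4]» for entries [4] does not print; mechanism for (3.47): (3.42) + [4] Lemma 2.1, kernel-available at
function level as `B9Ineq347AllEntries.glob347_allEntries`, not yet read into `KernelFamily.glob`); count-neutral; NOT a node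
discharge; one finite lattice programme — nothing continuum, nothing about the mass gap.  Cell `pub-ymgap` (HUMAN RULING D-0062),
Track A node N06 [B9], N06-ASSIGNMENT v1 rows 11–12 (bundle F3), seat `pub-ymgap-dag-n06-h`, 2026-08-26.
-/

noncomputable section

namespace Literature.MathematicalPhysics.QuantumFieldTheory.Balaban1983to89.B9ResidualEntriesAtOne

open B9FromB6 B9FromB6ModelSignsOn B9SectBStepWhole
open B6KLevelCensusIndexV1 (KIdx)
open B9GeoNormsKLevelV1 (geo9K)
open B9PinMembersKLevelV1 (MemberY geo9Y bg9Y)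
open B9PinCarriersKLevelV1 (OperatorLayerY)

/-! ## §1 The blocks ON a sub-family of arguments; ON + null OFF ⇒ the block -/

section Blocks

variable {g : B9.Geometry} {B : B9.Backgrounds}

/-- (3.46) for the arguments `lam` with `P lam` only (the L² entries, constants (B₀, δ₀), configuration U).
[cite: Balaban1985BackgroundPropagators, (3.46) p.398] -/
def L2BlockOn (K : B9.KernelFamily g B) (P : g.Loc → Prop) (B₀ δ₀ : ℝ) (U : B.Cfg) : Prop :=
  ∀ (n : Fin 6) (lam : g.Loc) (h : g.Cut) (y y' : g.Site), P lam → g.cutIn h y → g.suppIn lam y' →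
    K.l2 n U lam h ≤ B₀ * B9.pref6 (g.len y) n * g.cutSup h * Real.exp (-(δ₀ * g.dist y y')) * g.l2Norm lam

/-- (3.47) for the arguments with `P lam` only (the four weighted entries, γ ∈ [−4, 4], constant B₀, configuration U).
[cite: Balaban1985BackgroundPropagators, (3.47) p.398] -/
def GlobBlockOn (K : B9.KernelFamily g B) (P : g.Loc → Prop) (B₀ : ℝ) (U : B.Cfg) : Prop :=
  ∀ (n : Fin 4) (lam : g.Loc) (γ : ℝ), P lam → -4 ≤ γ → γ ≤ 4 → K.glob n U lam γ ≤ B₀ * g.wNorm γ lam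

/-- (3.43) (Δ̃-cut-offs, as printed) for the arguments with `P lam` only. [cite: Balaban1985BackgroundPropagators, (3.43) p.398] -/
def H1BlockOn (K : B9.KernelFamily g B) (P : g.Loc → Prop) (Bβ : ℝ → ℝ) (δ₀ : ℝ) (U : B.Cfg) : Prop :=
  ∀ (β : ℝ) (lam : g.Loc) (ζ : g.Cut) (y y' : g.Site), P lam → 0 ≤ β → β < 1 → g.cutInT ζ y → g.suppIn lam y' →
    K.h1 U lam β ζ ≤ Bβ β * (g.len y) ^ (1 - β) * g.cutH β ζ * Real.exp (-(δ₀ * g.dist y y')) * g.supNorm lam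

/-- (3.44) for the arguments with `P lam` only. [cite: Balaban1985BackgroundPropagators, (3.44) p.398] -/
def E4BlockOn (K : B9.KernelFamily g B) (P : g.Loc → Prop) (Bε : ℝ → ℝ) (δ₀ : ℝ) (U : B.Cfg) : Prop :=
  ∀ (ε : ℝ) (lam : g.Loc) (y y' : g.Site), P lam → 0 < ε → ε ≤ 1 → g.suppInT lam y' →
    K.e4 U lam y ≤ Bε ε * Real.exp (-(δ₀ * g.dist y y')) * (g.holder ε lam + g.supNorm lam)

/-- (3.45) for the arguments with `P lam` only. [cite: Balaban1985BackgroundPropagators, (3.45) p.398] -/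
def H2BlockOn (K : B9.KernelFamily g B) (P : g.Loc → Prop) (Bεβ : ℝ → ℝ → ℝ) (δ₀ : ℝ) (U : B.Cfg) : Prop :=
  ∀ (ε β : ℝ) (lam : g.Loc) (ζ : g.Cut) (y y' : g.Site), P lam → 0 < ε → ε ≤ 1 → 0 ≤ β → β < 1 →
    g.cutInT ζ y → g.suppInT lam y' →
    K.h2 U lam β ζ ≤ Bεβ ε β * (g.len y) ^ (-β) * g.cutH β ζ * Real.exp (-(δ₀ * g.dist y y')) *
      (g.holder (β + ε) lam + g.supNorm lam)

variable {K : B9.KernelFamily g B} {P Q : g.Loc → Prop} {U : B.Cfg}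

/-- the (3.46) block gives the block ON every sub-family. [cite: Balaban1985BackgroundPropagators, (3.46) p.398 (bookkeeping)] -/
theorem l2BlockOn_of_l2Block {B₀ δ₀ : ℝ} (h : L2Block K B₀ δ₀ U) : L2BlockOn K P B₀ δ₀ U :=
  fun n lam hc y y' _ hcut hs => h n lam hc y y' hcut hs

/-- the (3.47) block gives the block ON every sub-family. [cite: Balaban1985BackgroundPropagators, (3.47) p.398 (bookkeeping)] -/
theorem globBlockOn_of_globBlock {B₀ : ℝ} (h : GlobBlock K B₀ U) : GlobBlockOn K P B₀ U :=
  fun n lam γ _ h1 h2 => h n lam γ h1 h2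

/-- the (3.43) block gives the block ON every sub-family. [cite: Balaban1985BackgroundPropagators, (3.43) p.398 (bookkeeping)] -/
theorem h1BlockOn_of_h1Block {Bβ : ℝ → ℝ} {δ₀ : ℝ} (h : H1Block K Bβ δ₀ U) : H1BlockOn K P Bβ δ₀ U :=
  fun β lam ζ y y' _ h0 h1 hζ hs => h β lam ζ y y' h0 h1 hζ hs

/-- the (3.44) block gives the block ON every sub-family. [cite: Balaban1985BackgroundPropagators, (3.44) p.398 (bookkeeping)] -/
theorem e4BlockOn_of_e4Block {Bε : ℝ → ℝ} {δ₀ : ℝ} (h : E4Block K Bε δ₀ U) : E4BlockOn K P Bε δ₀ U :=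
  fun ε lam y y' _ h0 h1 hs => h ε lam y y' h0 h1 hs

/-- the (3.45) block gives the block ON every sub-family. [cite: Balaban1985BackgroundPropagators, (3.45) p.398 (bookkeeping)] -/
theorem h2BlockOn_of_h2Block {Bεβ : ℝ → ℝ → ℝ} {δ₀ : ℝ} (h : H2Block K Bεβ δ₀ U) : H2BlockOn K P Bεβ δ₀ U :=
  fun ε β lam ζ y y' _ h0 h1 h2 h3 hζ hs => h ε β lam ζ y y' h0 h1 h2 h3 hζ hs

/-- ON the full family (`P ≡ True`) the restricted (3.46) block IS the block. [cite: Balaban1985BackgroundPropagators, (3.46) p.398 (bookkeeping)] -/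
theorem l2Block_iff_on_true {B₀ δ₀ : ℝ} : L2Block K B₀ δ₀ U ↔ L2BlockOn K (fun _ => True) B₀ δ₀ U :=
  ⟨l2BlockOn_of_l2Block, fun h n lam hc y y' hcut hs => h n lam hc y y' trivial hcut hs⟩

/-- ON `P ≡ True` the restricted (3.47) block IS the block. [cite: Balaban1985BackgroundPropagators, (3.47) p.398 (bookkeeping)] -/
theorem globBlock_iff_on_true {B₀ : ℝ} : GlobBlock K B₀ U ↔ GlobBlockOn K (fun _ => True) B₀ U :=
  ⟨globBlockOn_of_globBlock, fun h n lam γ h1 h2 => h n lam γ trivial h1 h2⟩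

/-- ON `P ≡ True` the restricted (3.43) block IS the block. [cite: Balaban1985BackgroundPropagators, (3.43) p.398 (bookkeeping)] -/
theorem h1Block_iff_on_true {Bβ : ℝ → ℝ} {δ₀ : ℝ} : H1Block K Bβ δ₀ U ↔ H1BlockOn K (fun _ => True) Bβ δ₀ U :=
  ⟨h1BlockOn_of_h1Block, fun h β lam ζ y y' h0 h1 hζ hs => h β lam ζ y y' trivial h0 h1 hζ hs⟩

/-- ON `P ≡ True` the restricted (3.44) block IS the block. [cite: Balaban1985BackgroundPropagators, (3.44) p.398 (bookkeeping)] -/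
theorem e4Block_iff_on_true {Bε : ℝ → ℝ} {δ₀ : ℝ} : E4Block K Bε δ₀ U ↔ E4BlockOn K (fun _ => True) Bε δ₀ U :=
  ⟨e4BlockOn_of_e4Block, fun h ε lam y y' h0 h1 hs => h ε lam y y' trivial h0 h1 hs⟩

/-- ON `P ≡ True` the restricted (3.45) block IS the block. [cite: Balaban1985BackgroundPropagators, (3.45) p.398 (bookkeeping)] -/
theorem h2Block_iff_on_true {Bεβ : ℝ → ℝ → ℝ} {δ₀ : ℝ} : H2Block K Bεβ δ₀ U ↔ H2BlockOn K (fun _ => True) Bεβ δ₀ U :=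
  ⟨h2BlockOn_of_h2Block, fun h ε β lam ζ y y' h0 h1 h2 h3 hζ hs => h ε β lam ζ y y' trivial h0 h1 h2 h3 hζ hs⟩

/-- **(3.46) from «(3.46) ON `P`» and «the L² quantities are `≤ 0` OFF `P`»** (B₀ ≥ 0; sign facts of the norms: the right-hand
side is ≥ 0).  At a carrier whose operator is read on one summand of a sum-typed `Loc` and as `0` on the other, the second
hypothesis holds by `rfl`. [cite: Balaban1985BackgroundPropagators, (3.46) p.398 + (3.39)–(3.41) p.397] -/
theorem l2Block_of_on_of_null (S : ModelSignsOn g Q) {B₀ δ₀ : ℝ} (hB : 0 ≤ B₀) (hon : L2BlockOn K P B₀ δ₀ U)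
    (hoff : ∀ (n : Fin 6) (lam : g.Loc) (h : g.Cut), ¬ P lam → K.l2 n U lam h ≤ 0) : L2Block K B₀ δ₀ U := by
  intro n lam hc y y' hcut hs
  by_cases hP : P lam
  · exact hon n lam hc y y' hP hcut hs
  · exact (hoff n lam hc hP).trans (mul_nonneg (mul_nonneg (mul_nonneg (mul_nonneg hB (pref6_nonneg (S.len_nonneg y) n))
      (S.cutSup_nonneg hc)) (Real.exp_nonneg _)) (S.l2Norm_nonneg lam))

/-- **(3.47) from «(3.47) ON `P`» and «the weighted quantities are `≤ 0` OFF `P`»** (B₀ ≥ 0, |λ|_{(γ)} ≥ 0).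
[cite: Balaban1985BackgroundPropagators, (3.47) p.398 + (3.41) p.397] -/
theorem globBlock_of_on_of_null (S : ModelSignsOn g Q) {B₀ : ℝ} (hB : 0 ≤ B₀) (hon : GlobBlockOn K P B₀ U)
    (hoff : ∀ (n : Fin 4) (lam : g.Loc) (γ : ℝ), ¬ P lam → K.glob n U lam γ ≤ 0) : GlobBlock K B₀ U := by
  intro n lam γ h1 h2
  by_cases hP : P lam
  · exact hon n lam γ hP h1 h2
  · exact (hoff n lam γ hP).trans (mul_nonneg hB (S.wNorm_nonneg γ lam))

/-- **(3.43) from «(3.43) ON `P`» and «the Hölder quantity is `≤ 0` OFF `P`»** (B₀(β) ≥ 0, (Lʲη)^{1−β} ≥ 0, ‖ζ‖ + |ζ| ≥ 0, |λ| ≥ 0).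
[cite: Balaban1985BackgroundPropagators, (3.43) p.398 + (3.39)–(3.41) p.397] -/
theorem h1Block_of_on_of_null (S : ModelSignsOn g Q) {Bβ : ℝ → ℝ} {δ₀ : ℝ} (hB : ∀ β, 0 ≤ Bβ β) (hon : H1BlockOn K P Bβ δ₀ U)
    (hoff : ∀ (lam : g.Loc) (β : ℝ) (ζ : g.Cut), ¬ P lam → K.h1 U lam β ζ ≤ 0) : H1Block K Bβ δ₀ U := by
  intro β lam ζ y y' h0 h1 hζ hs
  by_cases hP : P lam
  · exact hon β lam ζ y y' hP h0 h1 hζ hs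
  · exact (hoff lam β ζ hP).trans (mul_nonneg (mul_nonneg (mul_nonneg (mul_nonneg (hB β) (Real.rpow_nonneg (S.len_nonneg y) _))
      (S.cutH_nonneg β ζ)) (Real.exp_nonneg _)) (S.supNorm_nonneg lam))

/-- **(3.44) from «(3.44) ON `P`» and «`|(∇_UG∇*_Uλ)(x)|`'s reading is `≤ 0` OFF `P`»** (B′₀(ε) ≥ 0, ‖λ‖_ε + |λ| ≥ 0).
[cite: Balaban1985BackgroundPropagators, (3.44) p.398 + (3.39)–(3.40) p.397] -/
theorem e4Block_of_on_of_null (S : ModelSignsOn g Q) {Bε : ℝ → ℝ} {δ₀ : ℝ} (hB : ∀ ε, 0 ≤ Bε ε) (hon : E4BlockOn K P Bε δ₀ U)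
    (hoff : ∀ (lam : g.Loc) (y : g.Site), ¬ P lam → K.e4 U lam y ≤ 0) : E4Block K Bε δ₀ U := by
  intro ε lam y y' h0 h1 hs
  by_cases hP : P lam
  · exact hon ε lam y y' hP h0 h1 hs
  · exact (hoff lam y hP).trans
      (mul_nonneg (mul_nonneg (hB ε) (Real.exp_nonneg _)) (add_nonneg (S.holder_nonneg ε lam) (S.supNorm_nonneg lam)))

/-- **(3.45) from «(3.45) ON `P`» and «the Hölder quantity is `≤ 0` OFF `P`»** (B′₀(ε, β) ≥ 0, (Lʲη)^{−β} ≥ 0).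
[cite: Balaban1985BackgroundPropagators, (3.45) p.398 + (3.39)–(3.41) p.397] -/
theorem h2Block_of_on_of_null (S : ModelSignsOn g Q) {Bεβ : ℝ → ℝ → ℝ} {δ₀ : ℝ} (hB : ∀ ε β, 0 ≤ Bεβ ε β)
    (hon : H2BlockOn K P Bεβ δ₀ U) (hoff : ∀ (lam : g.Loc) (β : ℝ) (ζ : g.Cut), ¬ P lam → K.h2 U lam β ζ ≤ 0) :
    H2Block K Bεβ δ₀ U := by
  intro ε β lam ζ y y' h0 h1 h2 h3 hζ hs
  by_cases hP : P lam
  · exact hon ε β lam ζ y y' hP h0 h1 h2 h3 hζ hs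
  · exact (hoff lam β ζ hP).trans (mul_nonneg (mul_nonneg (mul_nonneg (mul_nonneg (hB ε β)
      (Real.rpow_nonneg (S.len_nonneg y) _)) (S.cutH_nonneg β ζ)) (Real.exp_nonneg _))
      (add_nonneg (S.holder_nonneg (β + ε) lam) (S.supNorm_nonneg lam)))

end Blocks

/-! ## §2 The per-block leaves AT U = 1 for a family, ON a sub-family of arguments -/

section Leaves

variable {I : Type}

/-- **The (3.46) leaf at U = 1 ON `P`**: *"proved in [4] … for U = 1"* read for the L² entries — one threshold M₁ and one pair
(B₀, δ₀) > 0 serving every member above the threshold (for G′(1) NOT printed in (2.67): G-B9-03a; for G(1) = (2.140)).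
[cite: Balaban1985BackgroundPropagators, Cor. 3.5 p.407 + (3.46) p.398] -/
def AtOneL2On (geo : I → B9.Geometry) (bg : I → B9.Backgrounds) (K : ∀ i, B9.KernelFamily (geo i) (bg i))
    (P : ∀ i, (geo i).Loc → Prop) : Prop :=
  ∃ M₁ B₀ δ₀ : ℝ, 0 < M₁ ∧ 0 < B₀ ∧ 0 < δ₀ ∧ ∀ i : I, M₁ ≤ (geo i).M → L2BlockOn (K i) (P i) B₀ δ₀ (bg i).one

/-- **The (3.47) leaf at U = 1 ON `P`** (one threshold, one B₀ > 0; for `P ≡ True` this is `B9FromB6.ResidualGAGlobAtOne geo bg K`,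
`residualGAGlobAtOne_iff_on_true`). [cite: Balaban1985BackgroundPropagators, Cor. 3.5 p.407 + (3.47) p.398] -/
def AtOneGlobOn (geo : I → B9.Geometry) (bg : I → B9.Backgrounds) (K : ∀ i, B9.KernelFamily (geo i) (bg i))
    (P : ∀ i, (geo i).Loc → Prop) : Prop :=
  ∃ M₁ B₀ : ℝ, 0 < M₁ ∧ 0 < B₀ ∧ ∀ i : I, M₁ ≤ (geo i).M → GlobBlockOn (K i) (P i) B₀ (bg i).one

/-- **The (3.43) leaf at U = 1 ON `P`** (Δ̃-cut-offs; one threshold, one rate δ₀ > 0, one B₀(·); for G′(1) the Δ̃-clause is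
NOT printed in (2.67) — G-B9-20). [cite: Balaban1985BackgroundPropagators, Cor. 3.5 p.407 + (3.43) p.398] -/
def AtOneH1On (geo : I → B9.Geometry) (bg : I → B9.Backgrounds) (K : ∀ i, B9.KernelFamily (geo i) (bg i))
    (P : ∀ i, (geo i).Loc → Prop) : Prop :=
  ∃ M₁ δ₀ : ℝ, ∃ Bβ : ℝ → ℝ, 0 < M₁ ∧ 0 < δ₀ ∧ ∀ i : I, M₁ ≤ (geo i).M → H1BlockOn (K i) (P i) Bβ δ₀ (bg i).one

/-- **The (3.44) leaf at U = 1 ON `P`** (one threshold, one rate, one B′₀(·)). [cite: Balaban1985BackgroundPropagators, Cor. 3.5 p.407 + (3.44) p.398] -/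
def AtOneE4On (geo : I → B9.Geometry) (bg : I → B9.Backgrounds) (K : ∀ i, B9.KernelFamily (geo i) (bg i))
    (P : ∀ i, (geo i).Loc → Prop) : Prop :=
  ∃ M₁ δ₀ : ℝ, ∃ Bε : ℝ → ℝ, 0 < M₁ ∧ 0 < δ₀ ∧ ∀ i : I, M₁ ≤ (geo i).M → E4BlockOn (K i) (P i) Bε δ₀ (bg i).one

/-- **The (3.45) leaf at U = 1 ON `P`** (one threshold, one rate, one B′₀(·,·)). [cite: Balaban1985BackgroundPropagators, Cor. 3.5 p.407 + (3.45) p.398] -/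
def AtOneH2On (geo : I → B9.Geometry) (bg : I → B9.Backgrounds) (K : ∀ i, B9.KernelFamily (geo i) (bg i))
    (P : ∀ i, (geo i).Loc → Prop) : Prop :=
  ∃ M₁ δ₀ : ℝ, ∃ Bεβ : ℝ → ℝ → ℝ, 0 < M₁ ∧ 0 < δ₀ ∧ ∀ i : I, M₁ ≤ (geo i).M → H2BlockOn (K i) (P i) Bεβ δ₀ (bg i).one

/-- **The (3.46) leaf at U = 1 ON `P`, MEMBER `n`** (the unit in which L² entries get proved: [4] (2.140) member by member, the
tree's `B9Ineq346L2Final` at U′U for the members ₁,₂,₃,₅). [cite: Balaban1985BackgroundPropagators, Cor. 3.5 p.407 + (3.46) p.398] -/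
def AtOneL2nOn (geo : I → B9.Geometry) (bg : I → B9.Backgrounds) (K : ∀ i, B9.KernelFamily (geo i) (bg i))
    (P : ∀ i, (geo i).Loc → Prop) (n : Fin 6) : Prop :=
  ∃ M₁ B₀ δ₀ : ℝ, 0 < M₁ ∧ 0 < B₀ ∧ 0 < δ₀ ∧ ∀ i : I, M₁ ≤ (geo i).M →
    ∀ (lam : (geo i).Loc) (h : (geo i).Cut) (y y' : (geo i).Site), P i lam → (geo i).cutIn h y → (geo i).suppIn lam y' →
      (K i).l2 n (bg i).one lam h ≤
        B₀ * B9.pref6 ((geo i).len y) n * (geo i).cutSup h * Real.exp (-(δ₀ * (geo i).dist y y')) * (geo i).l2Norm lam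

/-- **The (3.47) leaf at U = 1 ON `P`, MEMBER `n`** (|Kλ|_{(2+γ)}, |∇_UKλ|_{(1+γ)}, |K∇*_Uλ|_{(1+γ)}, |Δ_UKλ|_{(γ)} for n = 0, 1, 2, 3;
in print each a consequence of the corresponding (3.42) entry and [4] Lemma 2.1 — `B9Ineq347AllEntries`).
[cite: Balaban1985BackgroundPropagators, Cor. 3.5 p.407 + (3.47) p.398] -/
def AtOneGlobnOn (geo : I → B9.Geometry) (bg : I → B9.Backgrounds) (K : ∀ i, B9.KernelFamily (geo i) (bg i))
    (P : ∀ i, (geo i).Loc → Prop) (n : Fin 4) : Prop :=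
  ∃ M₁ B₀ : ℝ, 0 < M₁ ∧ 0 < B₀ ∧ ∀ i : I, M₁ ≤ (geo i).M →
    ∀ (lam : (geo i).Loc) (γ : ℝ), P i lam → -4 ≤ γ → γ ≤ 4 → (K i).glob n (bg i).one lam γ ≤ B₀ * (geo i).wNorm γ lam

/-- **The null readings at U = 1 OFF `P`**: every (3.43)–(3.47) quantity of `K i` is `≤ 0` on the arguments off `P i` (at a layer
reading the operator on one summand and as `0` on the other: by `rfl`). [cite: Balaban1985BackgroundPropagators, Cor. 3.5 p.407 (bookkeeping of the carriers' sum-typed arguments)] -/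
def NullOffAtOne (geo : I → B9.Geometry) (bg : I → B9.Backgrounds) (K : ∀ i, B9.KernelFamily (geo i) (bg i))
    (P : ∀ i, (geo i).Loc → Prop) : Prop :=
  ∀ i : I, (∀ (n : Fin 6) (lam : (geo i).Loc) (h : (geo i).Cut), ¬ P i lam → (K i).l2 n (bg i).one lam h ≤ 0) ∧
    (∀ (n : Fin 4) (lam : (geo i).Loc) (γ : ℝ), ¬ P i lam → (K i).glob n (bg i).one lam γ ≤ 0) ∧
    (∀ (lam : (geo i).Loc) (β : ℝ) (ζ : (geo i).Cut), ¬ P i lam → (K i).h1 (bg i).one lam β ζ ≤ 0) ∧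
    (∀ (lam : (geo i).Loc) (y : (geo i).Site), ¬ P i lam → (K i).e4 (bg i).one lam y ≤ 0) ∧
    (∀ (lam : (geo i).Loc) (β : ℝ) (ζ : (geo i).Cut), ¬ P i lam → (K i).h2 (bg i).one lam β ζ ≤ 0)

variable {geo : I → B9.Geometry} {bg : I → B9.Backgrounds} {K : ∀ i, B9.KernelFamily (geo i) (bg i)}
  {P : ∀ i, (geo i).Loc → Prop}

/-- OFF the empty complement (`P ≡ True`) there is nothing to read: `NullOffAtOne … (fun _ _ => True)` holds.
[cite: Balaban1985BackgroundPropagators, Cor. 3.5 p.407 (bookkeeping)] -/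
theorem nullOffAtOne_true : NullOffAtOne geo bg K (fun _ _ => True) :=
  fun _ => ⟨fun _ _ _ h => (h trivial).elim, fun _ _ _ h => (h trivial).elim, fun _ _ _ h => (h trivial).elim,
    fun _ _ h => (h trivial).elim, fun _ _ _ h => (h trivial).elim⟩

/-- **`B9FromB6.ResidualGAGlobAtOne geo bg K` IS the (3.47) leaf at U = 1 on the full family** (`P ≡ True`).
[cite: Balaban1985BackgroundPropagators, Cor. 3.5 p.407 + (3.47) p.398 (bookkeeping)] -/
theorem residualGAGlobAtOne_iff_on_true : ResidualGAGlobAtOne geo bg K ↔ AtOneGlobOn geo bg K (fun _ _ => True) := by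
  refine ⟨fun ⟨M₁, B₀, hM, hB, h⟩ => ⟨M₁, B₀, hM, hB, fun i hi => globBlockOn_of_globBlock (h i hi)⟩,
    fun ⟨M₁, B₀, hM, hB, h⟩ => ⟨M₁, B₀, hM, hB, fun i hi => globBlock_iff_on_true.2 (h i hi)⟩⟩

end Leaves

/-! ## §3 The merges: per-member ⇒ per-block, per-block ⇒ the residual leaves of the knit -/

section Merge

variable {I : Type} {geo : I → B9.Geometry} {bg : I → B9.Backgrounds} {K : ∀ i, B9.KernelFamily (geo i) (bg i)}
  {P Q : ∀ i, (geo i).Loc → Prop}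

/-- a finite family of positive thresholds has a common upper bound (max). [folklore] -/
private theorem exists_upper {k : ℕ} (M : Fin (k + 1) → ℝ) (hM : ∀ n, 0 < M n) : ∃ M₁ : ℝ, 0 < M₁ ∧ ∀ n, M n ≤ M₁ :=
  ⟨Finset.univ.sup' Finset.univ_nonempty M, (hM 0).trans_le (Finset.le_sup' M (Finset.mem_univ 0)),
    fun n => Finset.le_sup' M (Finset.mem_univ n)⟩

/-- a finite family of positive rates has a positive common lower bound (min). [folklore] -/
private theorem exists_lower {k : ℕ} (δ : Fin (k + 1) → ℝ) (hδ : ∀ n, 0 < δ n) : ∃ δ₀ : ℝ, 0 < δ₀ ∧ ∀ n, δ₀ ≤ δ n := by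
  obtain ⟨m, -, hm⟩ := Finset.exists_mem_eq_inf' (s := Finset.univ) Finset.univ_nonempty δ
  exact ⟨Finset.univ.inf' Finset.univ_nonempty δ, hm ▸ hδ m, fun n => Finset.inf'_le δ (Finset.mem_univ n)⟩

/-- **The six member-leaves of (3.46) at U = 1 ⇒ the (3.46) leaf** (M₁ = max, B₀ = max, δ₀ = min; weakening by
`B9FromB6.weaken5` under the sign facts). [cite: Balaban1985BackgroundPropagators, (3.46) p.398 + Cor. 3.5 p.407] -/
theorem atOneL2On_of_members (S : ∀ i, ModelSignsOn (geo i) (Q i)) (h : ∀ n : Fin 6, AtOneL2nOn geo bg K P n) :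
    AtOneL2On geo bg K P := by
  choose M B δ hM hB hδ H using h
  obtain ⟨M₁, hM₁, hMle⟩ := exists_upper M hM
  obtain ⟨B₀, hB₀, hBle⟩ := exists_upper B hB
  obtain ⟨δ₀, hδ₀, hδle⟩ := exists_lower δ hδ
  refine ⟨M₁, B₀, δ₀, hM₁, hB₀, hδ₀, fun i hi n lam hc y y' hP hcut hs => ?_⟩
  exact weaken5 (H n i ((hMle n).trans hi) lam hc y y' hP hcut hs) (hBle n) hB₀.le (pref6_nonneg ((S i).len_nonneg y) n)
    ((S i).cutSup_nonneg hc) ((S i).l2Norm_nonneg lam) (hδle n) ((S i).dist_nonneg y y')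

/-- **The four member-leaves of (3.47) at U = 1 ⇒ the (3.47) leaf** (M₁ = max, B₀ = max; |λ|_{(γ)} ≥ 0).
[cite: Balaban1985BackgroundPropagators, (3.47) p.398 + Cor. 3.5 p.407] -/
theorem atOneGlobOn_of_members (S : ∀ i, ModelSignsOn (geo i) (Q i)) (h : ∀ n : Fin 4, AtOneGlobnOn geo bg K P n) :
    AtOneGlobOn geo bg K P := by
  choose M B hM hB H using h
  obtain ⟨M₁, hM₁, hMle⟩ := exists_upper M hM
  obtain ⟨B₀, hB₀, hBle⟩ := exists_upper B hB
  refine ⟨M₁, B₀, hM₁, hB₀, fun i hi n lam γ hP h1 h2 => ?_⟩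
  exact (H n i ((hMle n).trans hi) lam γ hP h1 h2).trans (mul_le_mul_of_nonneg_right (hBle n) ((S i).wNorm_nonneg γ lam))

/-- conversely the (3.46) leaf gives each member-leaf. [cite: Balaban1985BackgroundPropagators, (3.46) p.398 (bookkeeping)] -/
theorem atOneL2nOn_of_atOneL2On (h : AtOneL2On geo bg K P) (n : Fin 6) : AtOneL2nOn geo bg K P n := by
  obtain ⟨M₁, B₀, δ₀, hM, hB, hδ, H⟩ := h
  exact ⟨M₁, B₀, δ₀, hM, hB, hδ, fun i hi lam hc y y' hP hcut hs => H i hi n lam hc y y' hP hcut hs⟩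

/-- conversely the (3.47) leaf gives each member-leaf. [cite: Balaban1985BackgroundPropagators, (3.47) p.398 (bookkeeping)] -/
theorem atOneGlobnOn_of_atOneGlobOn (h : AtOneGlobOn geo bg K P) (n : Fin 4) : AtOneGlobnOn geo bg K P n := by
  obtain ⟨M₁, B₀, hM, hB, H⟩ := h
  exact ⟨M₁, B₀, hM, hB, fun i hi lam γ hP h1 h2 => H i hi n lam γ hP h1 h2⟩

/-- ★ **THE KNIT'S `ResidualGpAtOne` FROM THE FIVE PER-BLOCK LEAVES AT U = 1 ON `P` AND THE NULL READINGS OFF `P`** — thresholds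
merged by max, the two B₀'s by max, the four rates by min, the Hölder constants floored at `0` (n06-c's `*_mono` weakenings under
the sign facts of (3.39)–(3.41), Hölder-monotonicity NOT used), then ON + null OFF ⇒ each block (§1).  Nothing of print asserted:
the five leaves are the printed-shape hypotheses «(3.43)Δ̃ ∕ (3.44) ∕ (3.45) ∕ (3.46) ∕ (3.47) for K(1)» (for K = G′ the cell's
G-B9-03a ∕ G-B9-20 ∕ G-A1-1 (b)). [cite: Balaban1985BackgroundPropagators, Cor. 3.5 p.407 + (3.43)–(3.47) p.398] -/
theorem residualGpAtOne_of_blocksOn_of_null (S : ∀ i, ModelSignsOn (geo i) (Q i)) (hnull : NullOffAtOne geo bg K P)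
    (hL2 : AtOneL2On geo bg K P) (hG : AtOneGlobOn geo bg K P) (hH1 : AtOneH1On geo bg K P) (hE4 : AtOneE4On geo bg K P)
    (hH2 : AtOneH2On geo bg K P) : ResidualGpAtOne geo bg K := by
  obtain ⟨ML, BL, δL, hML, hBL, hδL, HL⟩ := hL2
  obtain ⟨MG, BG, hMG, hBG, HG⟩ := hG
  obtain ⟨MH, δH, Bβ, hMH, hδH, HH⟩ := hH1
  obtain ⟨ME, δE, Bε, hME, hδE, HE⟩ := hE4
  obtain ⟨M2, δ2, Bεβ, hM2, hδ2, H2⟩ := hH2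
  refine ⟨max (max (max (max ML MG) MH) ME) M2, max BL BG, min (min (min δL δH) δE) δ2, fun β => max 0 (Bβ β),
    fun ε => max 0 (Bε ε), fun ε β => max 0 (Bεβ ε β), lt_max_of_lt_right hM2, lt_max_of_lt_left hBL,
    lt_min (lt_min (lt_min hδL hδH) hδE) hδ2, fun i hi => ?_⟩
  have hiL : ML ≤ (geo i).M :=
    le_trans (le_trans (le_max_left _ _) (le_trans (le_max_left _ _) (le_trans (le_max_left _ _) (le_max_left _ _)))) hi
  have hiG : MG ≤ (geo i).M :=
    le_trans (le_trans (le_max_right _ _) (le_trans (le_max_left _ _) (le_trans (le_max_left _ _) (le_max_left _ _)))) hi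
  have hiH : MH ≤ (geo i).M := le_trans (le_trans (le_max_right _ _) (le_trans (le_max_left _ _) (le_max_left _ _))) hi
  have hiE : ME ≤ (geo i).M := le_trans (le_trans (le_max_right _ _) (le_max_left _ _)) hi
  have hi2 : M2 ≤ (geo i).M := le_trans (le_max_right _ _) hi
  have hB0 : 0 ≤ max BL BG := le_trans hBL.le (le_max_left _ _)
  have hδ₁ : min (min (min δL δH) δE) δ2 ≤ δL := le_trans (min_le_left _ _) (le_trans (min_le_left _ _) (min_le_left _ _))
  have hδ₂ : min (min (min δL δH) δE) δ2 ≤ δH := le_trans (min_le_left _ _) (le_trans (min_le_left _ _) (min_le_right _ _))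
  have hδ₃ : min (min (min δL δH) δE) δ2 ≤ δE := le_trans (min_le_left _ _) (min_le_right _ _)
  have hδ₄ : min (min (min δL δH) δE) δ2 ≤ δ2 := min_le_right _ _
  obtain ⟨nL, nG, nH, nE, n2⟩ := hnull i
  refine ⟨?_, ?_, ?_, ?_, ?_⟩
  · exact l2Block_mono (S i) (l2Block_of_on_of_null (S i) hBL.le (HL i hiL) nL) (le_max_left _ _) hB0 hδ₁
  · exact globBlock_mono (S i) (globBlock_of_on_of_null (S i) hBG.le (HG i hiG) nG) (le_max_right _ _)
  · refine h1Block_mono (S i) (h1Block_of_on_of_null (S i) (fun β => le_max_left _ _) ?_ nH) (fun β => le_rfl)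
      (fun β => le_max_left _ _) hδ₂
    intro β lam ζ y y' hP h0 h1 hζ hs
    exact weaken5 (HH i hiH β lam ζ y y' hP h0 h1 hζ hs) (le_max_right _ _) (le_max_left _ _)
      (Real.rpow_nonneg ((S i).len_nonneg y) _) ((S i).cutH_nonneg β ζ) ((S i).supNorm_nonneg lam) le_rfl
      ((S i).dist_nonneg y y')
  · refine e4Block_mono (S i) (e4Block_of_on_of_null (S i) (fun ε => le_max_left _ _) ?_ nE) (fun ε => le_rfl)
      (fun ε => le_max_left _ _) hδ₃
    intro ε lam y y' hP h0 h1 hs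
    exact weaken3 (HE i hiE ε lam y y' hP h0 h1 hs) (le_max_right _ _) (le_max_left _ _)
      (add_nonneg ((S i).holder_nonneg ε lam) ((S i).supNorm_nonneg lam)) le_rfl ((S i).dist_nonneg y y')
  · refine h2Block_mono (S i) (h2Block_of_on_of_null (S i) (fun ε β => le_max_left _ _) ?_ n2) (fun ε β => le_rfl)
      (fun ε β => le_max_left _ _) hδ₄
    intro ε β lam ζ y y' hP h0 h1 h2 h3 hζ hs
    exact weaken5 (H2 i hi2 ε β lam ζ y y' hP h0 h1 h2 h3 hζ hs) (le_max_right _ _) (le_max_left _ _)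
      (Real.rpow_nonneg ((S i).len_nonneg y) _) ((S i).cutH_nonneg β ζ)
      (add_nonneg ((S i).holder_nonneg (β + ε) lam) ((S i).supNorm_nonneg lam)) le_rfl ((S i).dist_nonneg y y')

/-- ★ **THE KNIT'S `ResidualGAGlobAtOne` FROM THE (3.47) LEAF AT U = 1 ON `P` AND THE NULL READING OFF `P`.**
[cite: Balaban1985BackgroundPropagators, Cor. 3.5 p.407 + (3.47) p.398] -/
theorem residualGAGlobAtOne_of_globOn_of_null (S : ∀ i, ModelSignsOn (geo i) (Q i))
    (hnull : ∀ (i : I) (n : Fin 4) (lam : (geo i).Loc) (γ : ℝ), ¬ P i lam → (K i).glob n (bg i).one lam γ ≤ 0)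
    (hG : AtOneGlobOn geo bg K P) : ResidualGAGlobAtOne geo bg K := by
  obtain ⟨M₁, B₀, hM, hB, H⟩ := hG
  exact ⟨M₁, B₀, hM, hB, fun i hi => globBlock_of_on_of_null (S i) hB.le (H i hi) (hnull i)⟩

/-- ★ **`ResidualGpAtOne` FROM THE FIVE UNRESTRICTED PER-BLOCK LEAVES AT U = 1** (`P ≡ True`; no null hypothesis).
[cite: Balaban1985BackgroundPropagators, Cor. 3.5 p.407 + (3.43)–(3.47) p.398] -/
theorem residualGpAtOne_of_blocks (S : ∀ i, ModelSignsOn (geo i) (Q i)) (hL2 : AtOneL2On geo bg K (fun _ _ => True))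
    (hG : ResidualGAGlobAtOne geo bg K) (hH1 : AtOneH1On geo bg K (fun _ _ => True))
    (hE4 : AtOneE4On geo bg K (fun _ _ => True)) (hH2 : AtOneH2On geo bg K (fun _ _ => True)) :
    ResidualGpAtOne geo bg K :=
  residualGpAtOne_of_blocksOn_of_null S nullOffAtOne_true hL2 (residualGAGlobAtOne_iff_on_true.1 hG) hH1 hE4 hH2

/-- `ResidualGAGlobAtOne` from its four unrestricted member-leaves at U = 1. [cite: Balaban1985BackgroundPropagators, Cor. 3.5 p.407 + (3.47) p.398] -/
theorem residualGAGlobAtOne_of_members (S : ∀ i, ModelSignsOn (geo i) (Q i))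
    (h : ∀ n : Fin 4, AtOneGlobnOn geo bg K (fun _ _ => True) n) : ResidualGAGlobAtOne geo bg K :=
  residualGAGlobAtOne_iff_on_true.2 (atOneGlobOn_of_members S h)

/-- The leaves are NECESSARY too: `ResidualGpAtOne` gives the (3.46) leaf at U = 1 ON every `P`.
[cite: Balaban1985BackgroundPropagators, (3.46) p.398 (bookkeeping)] -/
theorem atOneL2On_of_residualGpAtOne (h : ResidualGpAtOne geo bg K) : AtOneL2On geo bg K P := by
  obtain ⟨M₁, B₀, δ₀, Bβ, Bε, Bεβ, hM, hB, hδ, H⟩ := h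
  exact ⟨M₁, B₀, δ₀, hM, hB, hδ, fun i hi => l2BlockOn_of_l2Block (H i hi).1⟩

/-- `ResidualGpAtOne` gives the (3.47) leaf (i.e. `ResidualGAGlobAtOne` of the same family).
[cite: Balaban1985BackgroundPropagators, (3.47) p.398 (bookkeeping)] -/
theorem residualGAGlobAtOne_of_residualGpAtOne (h : ResidualGpAtOne geo bg K) : ResidualGAGlobAtOne geo bg K := by
  obtain ⟨M₁, B₀, δ₀, Bβ, Bε, Bεβ, hM, hB, hδ, H⟩ := h
  exact ⟨M₁, B₀, hM, hB, fun i hi => (H i hi).2.1⟩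

/-- `ResidualGpAtOne` gives the (3.43) leaf at U = 1 ON every `P`. [cite: Balaban1985BackgroundPropagators, (3.43) p.398 (bookkeeping)] -/
theorem atOneH1On_of_residualGpAtOne (h : ResidualGpAtOne geo bg K) : AtOneH1On geo bg K P := by
  obtain ⟨M₁, B₀, δ₀, Bβ, Bε, Bεβ, hM, hB, hδ, H⟩ := h
  exact ⟨M₁, δ₀, Bβ, hM, hδ, fun i hi => h1BlockOn_of_h1Block (H i hi).2.2.1⟩

/-- `ResidualGpAtOne` gives the (3.44) leaf at U = 1 ON every `P`. [cite: Balaban1985BackgroundPropagators, (3.44) p.398 (bookkeeping)] -/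
theorem atOneE4On_of_residualGpAtOne (h : ResidualGpAtOne geo bg K) : AtOneE4On geo bg K P := by
  obtain ⟨M₁, B₀, δ₀, Bβ, Bε, Bεβ, hM, hB, hδ, H⟩ := h
  exact ⟨M₁, δ₀, Bε, hM, hδ, fun i hi => e4BlockOn_of_e4Block (H i hi).2.2.2.1⟩

/-- `ResidualGpAtOne` gives the (3.45) leaf at U = 1 ON every `P`. [cite: Balaban1985BackgroundPropagators, (3.45) p.398 (bookkeeping)] -/
theorem atOneH2On_of_residualGpAtOne (h : ResidualGpAtOne geo bg K) : AtOneH2On geo bg K P := by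
  obtain ⟨M₁, B₀, δ₀, Bβ, Bε, Bεβ, hM, hB, hδ, H⟩ := h
  exact ⟨M₁, δ₀, Bεβ, hM, hδ, fun i hi => h2BlockOn_of_h2Block (H i hi).2.2.2.2⟩

/-- `ResidualGAGlobAtOne` gives the (3.47) leaf ON every `P`. [cite: Balaban1985BackgroundPropagators, (3.47) p.398 (bookkeeping)] -/
theorem atOneGlobOn_of_residualGAGlobAtOne (h : ResidualGAGlobAtOne geo bg K) : AtOneGlobOn geo bg K P := by
  obtain ⟨M₁, B₀, hM, hB, H⟩ := h
  exact ⟨M₁, B₀, hM, hB, fun i hi => globBlockOn_of_globBlock (H i hi)⟩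

/-- **Summary iff**: given the null readings OFF `P`, `ResidualGpAtOne` ⟺ the five per-block leaves at U = 1 ON `P`.
[cite: Balaban1985BackgroundPropagators, Cor. 3.5 p.407 + (3.43)–(3.47) p.398 (bookkeeping)] -/
theorem residualGpAtOne_iff_blocksOn (S : ∀ i, ModelSignsOn (geo i) (Q i)) (hnull : NullOffAtOne geo bg K P) :
    ResidualGpAtOne geo bg K ↔ AtOneL2On geo bg K P ∧ AtOneGlobOn geo bg K P ∧ AtOneH1On geo bg K P ∧
      AtOneE4On geo bg K P ∧ AtOneH2On geo bg K P :=
  ⟨fun h => ⟨atOneL2On_of_residualGpAtOne h, atOneGlobOn_of_residualGAGlobAtOne (residualGAGlobAtOne_of_residualGpAtOne h),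
      atOneH1On_of_residualGpAtOne h, atOneE4On_of_residualGpAtOne h, atOneH2On_of_residualGpAtOne h⟩,
    fun ⟨h1, h2, h3, h4, h5⟩ => residualGpAtOne_of_blocksOn_of_null S hnull h1 h2 h3 h4 h5⟩

end Merge

/-! ## §4 At the Stage-3′(Y) carriers: the knit binders `hGp`, `hGA` over def-Y's operator-layer signature -/

section StageY

variable {d ℓ : ℕ} {hd : 1 ≤ d + 1} {hL : Odd (ℓ + 1) ∧ 1 < ℓ + 1} {b₀ b₁ : ℝ} {Mstar : ℕ}

/-- NODE 00's reading of [4] Prop. 2.2's Hölder quantity of G′ = Δ′_a⁻¹ VANISHES on a BOND argument (`Node00.GpU.h1 (.inr _, _) := 0`).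
[cite: Balaban1984PropagatorsII, Prop. 2.2 (2.67) p.234 (the reading; bookkeeping)] -/
theorem GpU_h1_of_isRight (i : KIdx d ℓ hd hL b₀ b₁) {lam : Node00.KLoc i} (h : lam.isRight = true) (β : ℝ) (ζ : Node00.KCut i) :
    (Node00.GpU i).h1 lam β ζ = 0 := by
  cases lam with
  | inl f => exact absurd h (by simp)
  | inr J => cases ζ <;> rfl

/-- **The null reading of G′(1)'s (3.43) quantity on BOND arguments follows from the `U = 1` comparison against `Node00.GpU`** (the
knit binder `hGp_h1`; ANY backgrounds, ANY kernel family over `geo9K i`). [cite: Balaban1985BackgroundPropagators, Cor. 3.5 p.407; Balaban1984PropagatorsII, (2.67) p.234] -/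
theorem Gp_h1_null_of_le_GpU (i : KIdx d ℓ hd hL b₀ b₁) {B : B9.Backgrounds} (Gp : B9.KernelFamily (geo9K i) B)
    (hGp_h1 : ∀ (lam : (geo9K i).Loc) (b : ℝ) (ζ : (geo9K i).Cut), Gp.h1 B.one lam b ζ ≤ (Node00.GpU i).h1 lam b ζ)
    (lam : (geo9K i).Loc) (h : lam.isRight = true) (β : ℝ) (ζ : (geo9K i).Cut) : Gp.h1 B.one lam β ζ ≤ 0 :=
  (hGp_h1 lam β ζ).trans_eq (GpU_h1_of_isRight i h β ζ)

variable {𝔸 : Type} [NormedRing 𝔸] [NormedAlgebra ℂ 𝔸] [CompleteSpace 𝔸] {G : Subgroup 𝔸ˣ}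
variable (ops : ∀ x : MemberY d ℓ hd hL b₀ b₁ Mstar, OperatorLayerY d ℓ hd hL b₀ b₁ Mstar 𝔸 G x)

/-- ★ **THE KNIT BINDER `hGp` (`ResidualGpAtOne` for `(ops ·).Gp` at the Stage-3′(Y) carriers) FROM: the five per-block U = 1 leaves of
G′(1) ON SITE ARGUMENTS (`¬ lam.isRight`: (3.46), (3.47), (3.43)Δ̃, (3.44), (3.45) — the printed-shape hypotheses, G-B9-03a ∕ G-B9-20),
the null readings of its (3.46)∕(3.47)∕(3.44)∕(3.45) quantities on BOND arguments (by `rfl` at a layer reading G′ on the site summand,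
as NODE 00's `GpU`), and the knit binder `hGp_h1` (which supplies the (3.43) null reading, `Gp_h1_null_of_le_GpU`).**  Signs: dag-n03-b's
`modelSignsOn_geo9K`.  Every operator layer over def-Y's signature. [cite: Balaban1985BackgroundPropagators, Cor. 3.5 p.407 + (3.43)–(3.47) p.398; Balaban1984PropagatorsII, Prop. 2.2 (2.67) p.234] -/
theorem hGp_of_blocksOn_of_null
    (hGp_h1 : ∀ (x : MemberY d ℓ hd hL b₀ b₁ Mstar) (lam : (geo9Y x).Loc) (b : ℝ) (ζ : (geo9Y x).Cut),
      (ops x).Gp.h1 (bg9Y 𝔸 G x).one lam b ζ ≤ (Node00.GpU x.toKIdx).h1 lam b ζ)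
    (hnullL2 : ∀ (x : MemberY d ℓ hd hL b₀ b₁ Mstar) (n : Fin 6) (lam : (geo9Y x).Loc) (h : (geo9Y x).Cut), lam.isRight = true →
      (ops x).Gp.l2 n (bg9Y 𝔸 G x).one lam h ≤ 0)
    (hnullG : ∀ (x : MemberY d ℓ hd hL b₀ b₁ Mstar) (n : Fin 4) (lam : (geo9Y x).Loc) (γ : ℝ), lam.isRight = true →
      (ops x).Gp.glob n (bg9Y 𝔸 G x).one lam γ ≤ 0)
    (hnullE4 : ∀ (x : MemberY d ℓ hd hL b₀ b₁ Mstar) (lam : (geo9Y x).Loc) (y : (geo9Y x).Site), lam.isRight = true →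
      (ops x).Gp.e4 (bg9Y 𝔸 G x).one lam y ≤ 0)
    (hnullH2 : ∀ (x : MemberY d ℓ hd hL b₀ b₁ Mstar) (lam : (geo9Y x).Loc) (β : ℝ) (ζ : (geo9Y x).Cut), lam.isRight = true →
      (ops x).Gp.h2 (bg9Y 𝔸 G x).one lam β ζ ≤ 0)
    (hL2 : AtOneL2On geo9Y (bg9Y 𝔸 G) (fun x => (ops x).Gp) (fun _ lam => ¬ (lam.isRight = true)))
    (hG : AtOneGlobOn geo9Y (bg9Y 𝔸 G) (fun x => (ops x).Gp) (fun _ lam => ¬ (lam.isRight = true)))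
    (hH1 : AtOneH1On geo9Y (bg9Y 𝔸 G) (fun x => (ops x).Gp) (fun _ lam => ¬ (lam.isRight = true)))
    (hE4 : AtOneE4On geo9Y (bg9Y 𝔸 G) (fun x => (ops x).Gp) (fun _ lam => ¬ (lam.isRight = true)))
    (hH2 : AtOneH2On geo9Y (bg9Y 𝔸 G) (fun x => (ops x).Gp) (fun _ lam => ¬ (lam.isRight = true))) :
    ResidualGpAtOne geo9Y (bg9Y 𝔸 G) (fun x => (ops x).Gp) := by
  refine residualGpAtOne_of_blocksOn_of_null (fun x => B9GeoNormsKLevelModelSignsV1.modelSignsOn_geo9K x.toKIdx) (fun x => ?_)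
    hL2 hG hH1 hE4 hH2
  exact ⟨fun n lam h hP => hnullL2 x n lam h (Classical.not_not.mp hP), fun n lam γ hP => hnullG x n lam γ (Classical.not_not.mp hP),
    fun lam β ζ hP => Gp_h1_null_of_le_GpU x.toKIdx (ops x).Gp (hGp_h1 x) lam (Classical.not_not.mp hP) β ζ,
    fun lam y hP => hnullE4 x lam y (Classical.not_not.mp hP), fun lam β ζ hP => hnullH2 x lam β ζ (Classical.not_not.mp hP)⟩

/-- ★ **THE KNIT BINDER `hGA` (`ResidualGAGlobAtOne` for `(ops ·).GA`) FROM: the (3.47) leaf of G(1) at U = 1 ON BOND ARGUMENTS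
(`lam.isRight`; printed-shape hypothesis — in print a consequence of (3.42) for G(1) = [4] (2.136) and [4] Lemma 2.1, G-A1-1 (b)) and
the null reading of its weighted quantities on SITE arguments** (`rfl` at a layer reading G on the bond summand, as NODE 00's `GU`).
[cite: Balaban1985BackgroundPropagators, Cor. 3.5 p.407 + (3.47) p.398; Balaban1984PropagatorsII, Prop. 2.6 (2.136) p.247] -/
theorem hGA_of_globOn_of_null
    (hnull : ∀ (x : MemberY d ℓ hd hL b₀ b₁ Mstar) (n : Fin 4) (lam : (geo9Y x).Loc) (γ : ℝ), ¬ (lam.isRight = true) →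
      (ops x).GA.glob n (bg9Y 𝔸 G x).one lam γ ≤ 0)
    (hG : AtOneGlobOn geo9Y (bg9Y 𝔸 G) (fun x => (ops x).GA) (fun _ lam => lam.isRight = true)) :
    ResidualGAGlobAtOne geo9Y (bg9Y 𝔸 G) (fun x => (ops x).GA) :=
  residualGAGlobAtOne_of_globOn_of_null (fun x => B9GeoNormsKLevelModelSignsV1.modelSignsOn_geo9K x.toKIdx) hnull hG

/-- `hGA` from the four per-member (3.47) leaves of G(1) ON bond arguments + the null reading on site arguments.
[cite: Balaban1985BackgroundPropagators, Cor. 3.5 p.407 + (3.47) p.398] -/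
theorem hGA_of_globMembersOn_of_null
    (hnull : ∀ (x : MemberY d ℓ hd hL b₀ b₁ Mstar) (n : Fin 4) (lam : (geo9Y x).Loc) (γ : ℝ), ¬ (lam.isRight = true) →
      (ops x).GA.glob n (bg9Y 𝔸 G x).one lam γ ≤ 0)
    (hG : ∀ n : Fin 4, AtOneGlobnOn geo9Y (bg9Y 𝔸 G) (fun x => (ops x).GA) (fun _ lam => lam.isRight = true) n) :
    ResidualGAGlobAtOne geo9Y (bg9Y 𝔸 G) (fun x => (ops x).GA) :=
  hGA_of_globOn_of_null ops hnull
    (atOneGlobOn_of_members (fun x => B9GeoNormsKLevelModelSignsV1.modelSignsOn_geo9K x.toKIdx) hG)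

end StageY

end Literature.MathematicalPhysics.QuantumFieldTheory.Balaban1983to89.B9ResidualEntriesAtOne

end
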